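import Mathlib
import Summits.KontsevichZagierPeriods.KontsevichZagierPeriods.Theorems.SoloInformedLegendreSectorTwo
import HarnessLib
import HarnessLib.Audit

/-!
# Legendre's relation by moves, XVII: the `K`-hull of `⟦K⟧, ⟦E⟧` is a 2-isogeny invariant (solo-informed, s33)

THEOREM XXIII.  For every real algebraic modulus `k ∈ (0,1)` and its Landen transform
`k₁ = 2√k/(1+k)` (`k₁² = 4k/(1+k)²`), the `K`-hulls of the Legendre classes coincide in the
Kontsevich–Zagier period ring:

  `K[⟦K(k)⟧, ⟦E(k)⟧] = K[⟦K(k₁)⟧, ⟦E(k₁)⟧] ⊂ P`.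

Both inclusions are THEOREMS OF THE THREE RULES: `⟦K(k₁)⟧ = ⟦[pt,1+k]⟧⟦K(k)⟧` (THEOREM XIX,
Landen of the first kind = Gauss's AGM step by five moves) and
`⟦E(k₁)⟧ = ⟦[pt,2/(1+k)]⟧⟦E(k)⟧ − ⟦[pt,1−k]⟧⟦K(k)⟧` (THEOREM XX, Landen of the second kind),
inverted inside `P` using that point classes of non-zero algebraic numbers are units.  Hence
every statement about the sector — `evalP` injective on the hull ("KZP decided on the hull"),
algebraic independence of the two generators' values — is invariant under the level-2 modular
correspondence: decidedness PROPAGATES ALONG THE 2-ISOGENY GRAPH of real algebraic moduli.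

COROLLARY XXIII.2 (a third decided CM sector, discriminant `−16`).  At `k₄ = 3 − 2√2 = (√2−1)²`
one has `k₁² = 4k₄/(1+k₄)² = 1/2`: the Landen transform of `k₄` is the lemniscatic modulus.
So `K[⟦K(k₄)⟧, ⟦E(k₄)⟧] = K[⟦K(1/√2)⟧, ⟦E(1/√2)⟧]`, and by THEOREM XVIII (the lemniscatic
sector is decided, unconditionally, via `Γ(¼)` and Chudnovsky) the period conjecture holds on
`K[⟦K(3−2√2)⟧, ⟦E(3−2√2)⟧] ∋ ⟦π⟧`, and `K(3−2√2), E(3−2√2)` are algebraically independent —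
with no hypothesis (`K'(k₄)/K(k₄) = 2`: the lattice is `ℤ[2i]`).  (The Landen transform of
`k₂ = √2−1` is `k₂'`, consistent with XXI/XXII: `K[⟦K(k₂)⟧,⟦E(k₂)⟧] = K[⟦K(k₂')⟧,⟦E(k₂')⟧]`.)
References: Whittaker–Watson, Modern Analysis, § 22.42; Borwein–Borwein, Pi and the AGM (1987),
§§ 1.4–1.6, 2.7; Kontsevich–Zagier, Periods (2001), § 1.2; this work (THEOREMS XVIII–XXII).
-/

open MeasureTheory Set Filter
open scoped Classical

open Literature.NumberTheory.Transcendental Literature.NumberTheory.Transcendental.KZ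
open Literature.ModelTheory.ExponentialFields

namespace Summit.KontsevichZagierPeriods.KontsevichZagierPeriods.Theorems

/-! ### Hulls are monotone in their generators -/

/-- **Monotonicity of `K`-hulls**: if every `cᵢ` lies in `K[d]` then `K[c] ≤ K[d]`. [folklore] -/
theorem soloInformed_algHull_le_of_mem {k l : ℕ} (c : Fin k → FormalPeriodRing)
    (d : Fin l → FormalPeriodRing) (h : ∀ i, c i ∈ soloInformedAlgHull d) :
    soloInformedAlgHull c ≤ soloInformedAlgHull d := by
  rintro x ⟨p, rfl⟩
  induction p using MvPolynomial.induction_on with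
  | C a => rw [MvPolynomial.eval₂Hom_C]; exact soloInformed_pointHom_mem_algHull d a
  | add p q hp hq => rw [map_add]; exact add_mem hp hq
  | mul_X p i hp => rw [map_mul, MvPolynomial.eval₂Hom_X']; exact mul_mem hp (h i)

/-- Two families each lying in the other's hull generate the same hull. [folklore] -/
theorem soloInformed_algHull_eq_of_mem {k l : ℕ} (c : Fin k → FormalPeriodRing)
    (d : Fin l → FormalPeriodRing) (hcd : ∀ i, c i ∈ soloInformedAlgHull d)
    (hdc : ∀ j, d j ∈ soloInformedAlgHull c) :
    soloInformedAlgHull c = soloInformedAlgHull d :=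
  le_antisymm (soloInformed_algHull_le_of_mem c d hcd) (soloInformed_algHull_le_of_mem d c hdc)

/-! ### THEOREM XXIII: Landen invariance of the elliptic hull -/

/-- **THEOREM XXIII (the `K`-hull `K[⟦K⟧, ⟦E⟧]` is invariant under Landen's transformation).**
For a real algebraic modulus `k ∈ (0,1)`, Legendre representations `K, E` of modulus `k` and
`K₁, E₁` of modulus `k₁ = 2√k/(1+k)` on `(0,1)`:
  `K[⟦K⟧, ⟦E⟧] = K[⟦K₁⟧, ⟦E₁⟧]` in `P`.
`⊇`: THEOREMS XIX and XX.  `⊆`: the same two identities solved for `⟦K⟧, ⟦E⟧`, the point classes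
`⟦[pt,1+k]⟧`, `⟦[pt,2/(1+k)]⟧` being units of `K ⊂ P`. [this work] -/
theorem soloInformed_algHull_landen (k : ℝ) (hk : k ∈ Ioo (0:ℝ) 1) (hka : IsAlgebraic ℚ k)
    (K E K₁ E₁ : IntegralRep 1)
    (hKd : K.domain = {x : Fin 1 → ℝ | x 0 ∈ Ioo (0:ℝ) 1})
    (hKi : EqOn K.integrand (fun x => (√(1 - x 0 ^ 2))⁻¹ * (√(1 - k ^ 2 * x 0 ^ 2))⁻¹) K.domain)
    (hEd : E.domain = {x : Fin 1 → ℝ | x 0 ∈ Ioo (0:ℝ) 1})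
    (hEi : EqOn E.integrand (fun x => (1 - k ^ 2 * x 0 ^ 2) *
      ((√(1 - x 0 ^ 2))⁻¹ * (√(1 - k ^ 2 * x 0 ^ 2))⁻¹)) E.domain)
    (hK₁d : K₁.domain = {x : Fin 1 → ℝ | x 0 ∈ Ioo (0:ℝ) 1})
    (hK₁i : EqOn K₁.integrand
      (fun x => (√(1 - x 0 ^ 2))⁻¹ * (√(1 - (4 * k / (1 + k) ^ 2) * x 0 ^ 2))⁻¹) K₁.domain)
    (hE₁d : E₁.domain = {x : Fin 1 → ℝ | x 0 ∈ Ioo (0:ℝ) 1})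
    (hE₁i : EqOn E₁.integrand (fun x => (1 - (4 * k / (1 + k) ^ 2) * x 0 ^ 2) *
      ((√(1 - x 0 ^ 2))⁻¹ * (√(1 - (4 * k / (1 + k) ^ 2) * x 0 ^ 2))⁻¹)) E₁.domain) :
    soloInformedAlgHull ![toFormalPeriod (of K), toFormalPeriod (of E)] =
      soloInformedAlgHull ![toFormalPeriod (of K₁), toFormalPeriod (of E₁)] := by
  obtain ⟨hk0, hk1⟩ := hk
  have h1k0 : (1 + k : ℝ) ≠ 0 := by positivity
  have h2k0 : (2 / (1 + k) : ℝ) ≠ 0 := by positivity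
  have h1k : IsAlgebraic ℚ (1 + k) := isAlgebraic_one.add hka
  have h1ki : IsAlgebraic ℚ (1 + k)⁻¹ := h1k.inv
  have h2k : IsAlgebraic ℚ (2 / (1 + k)) := (isAlgebraic_nat (R := ℚ) (A := ℝ) 2).mul h1k.inv
  have h2ki : IsAlgebraic ℚ (2 / (1 + k))⁻¹ := h2k.inv
  have h1k' : IsAlgebraic ℚ (1 - k) := isAlgebraic_one.sub hka
  have hL1 := soloInformed_landen k ⟨hk0, hk1⟩ hka K K₁ hKd hKi hK₁d hK₁i h1k
  have hL2 := soloInformed_landen_second k ⟨hk0, hk1⟩ hka K E E₁ hKd hKi hEd hEi hE₁d hE₁i h2k h1k'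
  set c : Fin 2 → FormalPeriodRing := ![toFormalPeriod (of K), toFormalPeriod (of E)] with hc
  set d : Fin 2 → FormalPeriodRing := ![toFormalPeriod (of K₁), toFormalPeriod (of E₁)] with hd
  have hKc : toFormalPeriod (of K) ∈ soloInformedAlgHull c := soloInformed_mem_algHull_self c 0
  have hEc : toFormalPeriod (of E) ∈ soloInformedAlgHull c := soloInformed_mem_algHull_self c 1
  have hK₁d' : toFormalPeriod (of K₁) ∈ soloInformedAlgHull d := soloInformed_mem_algHull_self d 0
  have hE₁d' : toFormalPeriod (of E₁) ∈ soloInformedAlgHull d := soloInformed_mem_algHull_self d 1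
  -- the inverted identities
  have hKinv : toFormalPeriod (of K) =
      toFormalPeriod (of (IntegralRep.unit.constMul (1 + k)⁻¹ h1ki)) * toFormalPeriod (of K₁) := by
    rw [hL1, ← mul_assoc, soloInformed_pointRep_inv_mul (1 + k) h1k h1k0 h1ki, one_mul]
  have hEinv : toFormalPeriod (of E) =
      toFormalPeriod (of (IntegralRep.unit.constMul (2 / (1 + k))⁻¹ h2ki)) *
        (toFormalPeriod (of E₁) +
          toFormalPeriod (of (IntegralRep.unit.constMul (1 - k) h1k')) * toFormalPeriod (of K)) := by
    rw [hL2, sub_add_cancel, ← mul_assoc, soloInformed_pointRep_inv_mul (2 / (1 + k)) h2k h2k0 h2ki,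
      one_mul]
  have hKd' : toFormalPeriod (of K) ∈ soloInformedAlgHull d := by
    rw [hKinv]; exact mul_mem (soloInformed_pointRep_mem_algHull d _ h1ki) hK₁d'
  refine soloInformed_algHull_eq_of_mem c d (Fin.forall_fin_two.2 ⟨?_, ?_⟩)
    (Fin.forall_fin_two.2 ⟨?_, ?_⟩)
  · simpa [hc] using hKd'
  · simp only [hc, Matrix.cons_val_one, Matrix.cons_val_zero]
    rw [hEinv]
    exact mul_mem (soloInformed_pointRep_mem_algHull d _ h2ki)
      (add_mem hE₁d' (mul_mem (soloInformed_pointRep_mem_algHull d _ h1k') hKd'))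
  · simp only [hd, Matrix.cons_val_zero]
    rw [hL1]
    exact mul_mem (soloInformed_pointRep_mem_algHull c _ h1k) hKc
  · simp only [hd, Matrix.cons_val_one, Matrix.cons_val_zero]
    rw [hL2]
    exact sub_mem (mul_mem (soloInformed_pointRep_mem_algHull c _ h2k) hEc)
      (mul_mem (soloInformed_pointRep_mem_algHull c _ h1k') hKc)

/-! ### Algebraic independence along Landen -/

/-- **Transfer of algebraic independence through algebraic dependence**: if `x, y` are
algebraically independent over `ℚ` and both are ALGEBRAIC over `ℚ(a, b)`, then `a, b` are
algebraically independent over `ℚ` (`trdeg ℚ(a,b) = trdeg ℚ(a,b)(x,y) ≥ 2`). [folklore] -/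
theorem soloInformed_algebraicIndependent_pair_transfer_algebraic {x y a b : ℝ}
    (h : AlgebraicIndependent ℚ ![x, y])
    (hx : IsAlgebraic (IntermediateField.adjoin ℚ ({a, b} : Set ℝ)) x)
    (hy : IsAlgebraic (IntermediateField.adjoin ℚ ({a, b} : Set ℝ)) y) :
    AlgebraicIndependent ℚ ![a, b] := by
  set K : IntermediateField ℚ ℝ := IntermediateField.adjoin ℚ ({a, b} : Set ℝ) with hK
  set T : Set ℝ := {x, y} with hT
  have hTalg : ∀ t ∈ T, IsAlgebraic K t := by
    rintro t (rfl | rfl)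
    · exact hx
    · exact hy
  let E : IntermediateField K ℝ := IntermediateField.adjoin K T
  haveI : Algebra.IsAlgebraic K E :=
    IntermediateField.isAlgebraic_adjoin fun t ht ↦ (hTalg t ht).isIntegral
  haveI : FaithfulSMul ℚ K :=
    (faithfulSMul_iff_algebraMap_injective ℚ K).mpr (algebraMap ℚ K).injective
  haveI : FaithfulSMul K E :=
    (faithfulSMul_iff_algebraMap_injective K E).mpr (algebraMap K E).injective
  have hE : Algebra.trdeg ℚ E = Algebra.trdeg ℚ K := by
    rw [← trdeg_add_eq ℚ K (A := E), trdeg_eq_zero (R := K) (A := E), add_zero]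
  have hu : x ∈ E := IntermediateField.subset_adjoin K T (by simp [hT])
  have hv : y ∈ E := IntermediateField.subset_adjoin K T (by simp [hT])
  let g : Fin 2 → E := ![⟨_, hu⟩, ⟨_, hv⟩]
  have hg : AlgebraicIndependent ℚ g := by
    refine AlgebraicIndependent.of_comp (IsScalarTower.toAlgHom ℚ E ℝ) ?_
    convert h using 1
    ext i
    fin_cases i <;> rfl
  have h2 : (2 : Cardinal) ≤ Algebra.trdeg ℚ K := by
    calc (2 : Cardinal) = Cardinal.mk (Fin 2) := by simp
      _ ≤ Algebra.trdeg ℚ E := hg.cardinalMk_le_trdeg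
      _ = Algebra.trdeg ℚ K := hE
  refine Literature.Barriers.Schanuel.algebraicIndependent_of_le_trdeg_adjoin _ ?_
  rw [Matrix.range_cons_cons_empty]
  exact_mod_cast h2

/-- **COROLLARY XXIII.1 (algebraic independence of `K, E` is a Landen invariant).** With the
notation of THEOREM XXIII, `K(k), E(k)` are algebraically independent over `ℚ` iff
`K(k₁), E(k₁)` are: the values satisfy `K₁ = (1+k)K`, `E₁ = (2/(1+k))E − (1−k)K` (THEOREMS
XIX, XX under `evalP`), an invertible change of variables over `ℚ(k) ⊂ ℚ̄`. [this work] -/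
theorem soloInformed_algebraicIndependent_landen_iff (k : ℝ) (hk : k ∈ Ioo (0:ℝ) 1)
    (hka : IsAlgebraic ℚ k) (K E K₁ E₁ : IntegralRep 1)
    (hKd : K.domain = {x : Fin 1 → ℝ | x 0 ∈ Ioo (0:ℝ) 1})
    (hKi : EqOn K.integrand (fun x => (√(1 - x 0 ^ 2))⁻¹ * (√(1 - k ^ 2 * x 0 ^ 2))⁻¹) K.domain)
    (hEd : E.domain = {x : Fin 1 → ℝ | x 0 ∈ Ioo (0:ℝ) 1})
    (hEi : EqOn E.integrand (fun x => (1 - k ^ 2 * x 0 ^ 2) *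
      ((√(1 - x 0 ^ 2))⁻¹ * (√(1 - k ^ 2 * x 0 ^ 2))⁻¹)) E.domain)
    (hK₁d : K₁.domain = {x : Fin 1 → ℝ | x 0 ∈ Ioo (0:ℝ) 1})
    (hK₁i : EqOn K₁.integrand
      (fun x => (√(1 - x 0 ^ 2))⁻¹ * (√(1 - (4 * k / (1 + k) ^ 2) * x 0 ^ 2))⁻¹) K₁.domain)
    (hE₁d : E₁.domain = {x : Fin 1 → ℝ | x 0 ∈ Ioo (0:ℝ) 1})
    (hE₁i : EqOn E₁.integrand (fun x => (1 - (4 * k / (1 + k) ^ 2) * x 0 ^ 2) *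
      ((√(1 - x 0 ^ 2))⁻¹ * (√(1 - (4 * k / (1 + k) ^ 2) * x 0 ^ 2))⁻¹)) E₁.domain) :
    AlgebraicIndependent ℚ ![K.value, E.value] ↔ AlgebraicIndependent ℚ ![K₁.value, E₁.value] := by
  obtain ⟨hk0, hk1⟩ := hk
  have h1k0 : (1 + k : ℝ) ≠ 0 := by positivity
  have h1k : IsAlgebraic ℚ (1 + k) := isAlgebraic_one.add hka
  have h1k' : IsAlgebraic ℚ (1 - k) := isAlgebraic_one.sub hka
  have h2 : IsAlgebraic ℚ (2 : ℝ) := isAlgebraic_nat (R := ℚ) (A := ℝ) 2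
  have hvK := soloInformed_landen_value k ⟨hk0, hk1⟩ hka K K₁ hKd hKi hK₁d hK₁i
  have hvE := soloInformed_landen_second_value k ⟨hk0, hk1⟩ hka K E E₁ hKd hKi hEd hEi hE₁d hE₁i
  -- the inverse formulas
  have hvK' : K.value = (1 + k)⁻¹ * K₁.value := by
    rw [hvK]; field_simp
  have hvE' : E.value = (1 + k) / 2 * E₁.value + (1 - k) / 2 * K₁.value := by
    rw [hvE, hvK]; field_simp; ring
  constructor
  · intro hind
    set F : IntermediateField ℚ ℝ := IntermediateField.adjoin ℚ ({K₁.value, E₁.value} : Set ℝ)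
    have hF : ∀ z : ℝ, z ∈ F → IsAlgebraic F z := fun z hz => isAlgebraic_algebraMap (⟨z, hz⟩ : F)
    have hK₁F : IsAlgebraic F K₁.value := hF _ (IntermediateField.subset_adjoin ℚ _ (by simp))
    have hE₁F : IsAlgebraic F E₁.value := hF _ (IntermediateField.subset_adjoin ℚ _ (by simp))
    refine soloInformed_algebraicIndependent_pair_transfer_algebraic hind ?_ ?_
    · rw [hvK']; exact (h1k.inv.tower_top F).mul hK₁F
    · rw [hvE']
      exact ((h1k.mul h2.inv).tower_top F).mul hE₁F |>.add (((h1k'.mul h2.inv).tower_top F).mul hK₁F)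
  · intro hind
    set F : IntermediateField ℚ ℝ := IntermediateField.adjoin ℚ ({K.value, E.value} : Set ℝ)
    have hF : ∀ z : ℝ, z ∈ F → IsAlgebraic F z := fun z hz => isAlgebraic_algebraMap (⟨z, hz⟩ : F)
    have hKF : IsAlgebraic F K.value := hF _ (IntermediateField.subset_adjoin ℚ _ (by simp))
    have hEF : IsAlgebraic F E.value := hF _ (IntermediateField.subset_adjoin ℚ _ (by simp))
    refine soloInformed_algebraicIndependent_pair_transfer_algebraic hind ?_ ?_
    · rw [hvK]; exact (h1k.tower_top F).mul hKF
    · rw [hvE]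
      exact ((h2.mul h1k.inv).tower_top F).mul hEF |>.sub ((h1k'.tower_top F).mul hKF)

/-- **COROLLARY XXIII.1′ (decidedness is a Landen invariant).** If `K(k), E(k)` are algebraically
independent over `ℚ`, KZP holds on the hull `K[⟦K(k₁)⟧, ⟦E(k₁)⟧]` of the LANDEN-TRANSFORMED classes:
classes in it with equal values are equivalent under the three rules. [this work] -/
theorem soloInformed_kzp_on_hull_landen (k : ℝ) (hk : k ∈ Ioo (0:ℝ) 1) (hka : IsAlgebraic ℚ k)
    (K E K₁ E₁ : IntegralRep 1)
    (hKd : K.domain = {x : Fin 1 → ℝ | x 0 ∈ Ioo (0:ℝ) 1})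
    (hKi : EqOn K.integrand (fun x => (√(1 - x 0 ^ 2))⁻¹ * (√(1 - k ^ 2 * x 0 ^ 2))⁻¹) K.domain)
    (hEd : E.domain = {x : Fin 1 → ℝ | x 0 ∈ Ioo (0:ℝ) 1})
    (hEi : EqOn E.integrand (fun x => (1 - k ^ 2 * x 0 ^ 2) *
      ((√(1 - x 0 ^ 2))⁻¹ * (√(1 - k ^ 2 * x 0 ^ 2))⁻¹)) E.domain)
    (hK₁d : K₁.domain = {x : Fin 1 → ℝ | x 0 ∈ Ioo (0:ℝ) 1})
    (hK₁i : EqOn K₁.integrand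
      (fun x => (√(1 - x 0 ^ 2))⁻¹ * (√(1 - (4 * k / (1 + k) ^ 2) * x 0 ^ 2))⁻¹) K₁.domain)
    (hE₁d : E₁.domain = {x : Fin 1 → ℝ | x 0 ∈ Ioo (0:ℝ) 1})
    (hE₁i : EqOn E₁.integrand (fun x => (1 - (4 * k / (1 + k) ^ 2) * x 0 ^ 2) *
      ((√(1 - x 0 ^ 2))⁻¹ * (√(1 - (4 * k / (1 + k) ^ 2) * x 0 ^ 2))⁻¹)) E₁.domain)
    (hind : AlgebraicIndependent ℚ ![K.value, E.value])
    {n m : ℕ} (r : IntegralRep n) (r' : IntegralRep m)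
    (hr : toFormalPeriod (of r) ∈
      soloInformedAlgHull ![toFormalPeriod (of K₁), toFormalPeriod (of E₁)])
    (hr' : toFormalPeriod (of r') ∈
      soloInformedAlgHull ![toFormalPeriod (of K₁), toFormalPeriod (of E₁)])
    (hv : r.value = r'.value) : Equivalent r r' := by
  rw [← soloInformed_algHull_landen k hk hka K E K₁ E₁ hKd hKi hEd hEi hK₁d hK₁i hE₁d hE₁i] at hr hr'
  refine soloInformed_kzp_on_algHull _ (soloInformed_algebraicIndependent_evalP_pair ?_) r r' hr hr' hv
  rw [evalP_toFormalPeriod_of, evalP_toFormalPeriod_of]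
  exact hind

/-! ### COROLLARY XXIII.2: the CM sector of modulus `k₄ = 3 − 2√2` (discriminant `−16`) is decided -/

/-- `4k₄/(1+k₄)² = 1/2` for `k₄ = 3 − 2√2`: the Landen transform of `k₄` is the lemniscatic
modulus `1/√2`. [Borwein–Borwein 1987, § 1.6; this work] -/
theorem soloInformed_landen_threeSubTwoSqrtTwo :
    4 * (3 - 2 * √2) / (1 + (3 - 2 * √2)) ^ 2 = (1 / 2 : ℝ) := by
  have hs2 : (√2 : ℝ) ^ 2 = 2 := Real.sq_sqrt (by norm_num)
  have hs2' : (√2 : ℝ) < 3 / 2 := by nlinarith [Real.sqrt_nonneg 2]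
  have hne : (1 + (3 - 2 * √2) : ℝ) ≠ 0 := by nlinarith
  rw [div_eq_iff (pow_ne_zero 2 hne)]
  linear_combination (-2 : ℝ) * hs2

/-- **COROLLARY XXIII.2 (hull).** For Legendre representations `K, E` of modulus `k₄ = 3 − 2√2`
and `K₁, E₁` of the lemniscatic modulus (`k₁² = 1/2`) on `(0,1)`:
`K[⟦K(k₄)⟧, ⟦E(k₄)⟧] = K[⟦K(1/√2)⟧, ⟦E(1/√2)⟧]` in `P`. [this work] -/
theorem soloInformed_algHull_ellipticThreeSubTwoSqrtTwo (K E K₁ E₁ : IntegralRep 1)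
    (hKd : K.domain = {x : Fin 1 → ℝ | x 0 ∈ Ioo (0:ℝ) 1})
    (hKi : EqOn K.integrand
      (fun x => (√(1 - x 0 ^ 2))⁻¹ * (√(1 - (3 - 2 * √2) ^ 2 * x 0 ^ 2))⁻¹) K.domain)
    (hEd : E.domain = {x : Fin 1 → ℝ | x 0 ∈ Ioo (0:ℝ) 1})
    (hEi : EqOn E.integrand (fun x => (1 - (3 - 2 * √2) ^ 2 * x 0 ^ 2) *
      ((√(1 - x 0 ^ 2))⁻¹ * (√(1 - (3 - 2 * √2) ^ 2 * x 0 ^ 2))⁻¹)) E.domain)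
    (hK₁d : K₁.domain = {x : Fin 1 → ℝ | x 0 ∈ Ioo (0:ℝ) 1})
    (hK₁i : EqOn K₁.integrand
      (fun x => (√(1 - x 0 ^ 2))⁻¹ * (√(1 - (1 / 2 : ℝ) * x 0 ^ 2))⁻¹) K₁.domain)
    (hE₁d : E₁.domain = {x : Fin 1 → ℝ | x 0 ∈ Ioo (0:ℝ) 1})
    (hE₁i : EqOn E₁.integrand (fun x => (1 - (1 / 2 : ℝ) * x 0 ^ 2) *
      ((√(1 - x 0 ^ 2))⁻¹ * (√(1 - (1 / 2 : ℝ) * x 0 ^ 2))⁻¹)) E₁.domain) :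
    soloInformedAlgHull ![toFormalPeriod (of K), toFormalPeriod (of E)] =
      soloInformedAlgHull ![toFormalPeriod (of K₁), toFormalPeriod (of E₁)] := by
  have hs2 : (√2 : ℝ) ^ 2 = 2 := Real.sq_sqrt (by norm_num)
  have hlo : (4 / 3 : ℝ) < √2 := by nlinarith [Real.sqrt_nonneg 2]
  have hhi : (√2 : ℝ) < 3 / 2 := by nlinarith [Real.sqrt_nonneg 2]
  have hk : (3 - 2 * √2 : ℝ) ∈ Ioo (0:ℝ) 1 := ⟨by linarith, by linarith⟩
  have h2a : IsAlgebraic ℚ (√2 : ℝ) := ⟨Polynomial.X ^ 2 - Polynomial.C 2,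
    (Polynomial.monic_X_pow_sub_C (2 : ℚ) two_ne_zero).ne_zero, by simp [Real.sq_sqrt]⟩
  have hka : IsAlgebraic ℚ (3 - 2 * √2 : ℝ) :=
    (isAlgebraic_nat (R := ℚ) (A := ℝ) 3).sub ((isAlgebraic_nat (R := ℚ) (A := ℝ) 2).mul h2a)
  have hq := soloInformed_landen_threeSubTwoSqrtTwo
  refine soloInformed_algHull_landen (3 - 2 * √2) hk hka K E K₁ E₁ hKd hKi hEd hEi hK₁d ?_ hE₁d ?_
  · rw [hq]; exact hK₁i
  · rw [hq]; exact hE₁i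

/-- **COROLLARY XXIII.2 (independence).** `K(3−2√2)` and `E(3−2√2)` are algebraically
independent over `ℚ` — unconditionally, from THEOREM XVIII (`K(1/√2), E(1/√2)` independent via
`Γ(¼)` and Chudnovsky) transported along Landen. [this work] -/
theorem soloInformed_algebraicIndependent_ellipticThreeSubTwoSqrtTwo (K E : IntegralRep 1)
    (hKd : K.domain = {x : Fin 1 → ℝ | x 0 ∈ Ioo (0:ℝ) 1})
    (hKi : EqOn K.integrand
      (fun x => (√(1 - x 0 ^ 2))⁻¹ * (√(1 - (3 - 2 * √2) ^ 2 * x 0 ^ 2))⁻¹) K.domain)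
    (hEd : E.domain = {x : Fin 1 → ℝ | x 0 ∈ Ioo (0:ℝ) 1})
    (hEi : EqOn E.integrand (fun x => (1 - (3 - 2 * √2) ^ 2 * x 0 ^ 2) *
      ((√(1 - x 0 ^ 2))⁻¹ * (√(1 - (3 - 2 * √2) ^ 2 * x 0 ^ 2))⁻¹)) E.domain) :
    AlgebraicIndependent ℚ ![K.value, E.value] := by
  have hs2 : (√2 : ℝ) ^ 2 = 2 := Real.sq_sqrt (by norm_num)
  have hlo : (4 / 3 : ℝ) < √2 := by nlinarith [Real.sqrt_nonneg 2]
  have hhi : (√2 : ℝ) < 3 / 2 := by nlinarith [Real.sqrt_nonneg 2]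
  have hk : (3 - 2 * √2 : ℝ) ∈ Ioo (0:ℝ) 1 := ⟨by linarith, by linarith⟩
  have h2a : IsAlgebraic ℚ (√2 : ℝ) := ⟨Polynomial.X ^ 2 - Polynomial.C 2,
    (Polynomial.monic_X_pow_sub_C (2 : ℚ) two_ne_zero).ne_zero, by simp [Real.sq_sqrt]⟩
  have hka : IsAlgebraic ℚ (3 - 2 * √2 : ℝ) :=
    (isAlgebraic_nat (R := ℚ) (A := ℝ) 3).sub ((isAlgebraic_nat (R := ℚ) (A := ℝ) 2).mul h2a)
  have hμ : (1 / 2 : ℝ) ∈ Ioo (0:ℝ) 1 := ⟨by norm_num, by norm_num⟩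
  have hμa : IsAlgebraic ℚ (1 / 2 : ℝ) := by
    simpa using (isAlgebraic_nat (R := ℚ) (A := ℝ) 2).inv
  obtain ⟨K₁, hK₁d, hK₁i⟩ := soloInformed_exists_ellipticK_rep (1 / 2) hμ hμa
  obtain ⟨E₁, hE₁d, hE₁i⟩ := soloInformed_exists_ellipticE_rep (1 / 2) hμ hμa
  have hq := soloInformed_landen_threeSubTwoSqrtTwo
  have hind₁ := soloInformed_algebraicIndependent_ellipticHalf K₁ E₁ hK₁d (fun x _ => hK₁i x) hE₁d
    (fun x _ => hE₁i x)
  refine (soloInformed_algebraicIndependent_landen_iff (3 - 2 * √2) hk hka K E K₁ E₁ hKd hKi hEd hEi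
    hK₁d ?_ hE₁d ?_).2 hind₁
  · rw [hq]; exact fun x _ => hK₁i x
  · rw [hq]; exact fun x _ => hE₁i x

/-- **COROLLARY XXIII.2 (a third decided CM sector, discriminant `−16`).** On the `K`-hull
`K[⟦K(3−2√2)⟧, ⟦E(3−2√2)⟧] ⊂ P` the Kontsevich–Zagier period conjecture holds: representations
(any dimensions) with classes in the hull and equal values are equivalent under the three rules.
UNCONDITIONAL: THEOREM XVIII transported along Landen (THEOREM XXIII). [this work] -/
theorem soloInformed_kzp_on_hull_ellipticThreeSubTwoSqrtTwo (K E : IntegralRep 1)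
    (hKd : K.domain = {x : Fin 1 → ℝ | x 0 ∈ Ioo (0:ℝ) 1})
    (hKi : EqOn K.integrand
      (fun x => (√(1 - x 0 ^ 2))⁻¹ * (√(1 - (3 - 2 * √2) ^ 2 * x 0 ^ 2))⁻¹) K.domain)
    (hEd : E.domain = {x : Fin 1 → ℝ | x 0 ∈ Ioo (0:ℝ) 1})
    (hEi : EqOn E.integrand (fun x => (1 - (3 - 2 * √2) ^ 2 * x 0 ^ 2) *
      ((√(1 - x 0 ^ 2))⁻¹ * (√(1 - (3 - 2 * √2) ^ 2 * x 0 ^ 2))⁻¹)) E.domain)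
    {n m : ℕ} (r : IntegralRep n) (r' : IntegralRep m)
    (hr : toFormalPeriod (of r) ∈
      soloInformedAlgHull ![toFormalPeriod (of K), toFormalPeriod (of E)])
    (hr' : toFormalPeriod (of r') ∈
      soloInformedAlgHull ![toFormalPeriod (of K), toFormalPeriod (of E)])
    (hv : r.value = r'.value) : Equivalent r r' := by
  refine soloInformed_kzp_on_algHull _ (soloInformed_algebraicIndependent_evalP_pair ?_) r r' hr hr' hv
  rw [evalP_toFormalPeriod_of, evalP_toFormalPeriod_of]
  exact soloInformed_algebraicIndependent_ellipticThreeSubTwoSqrtTwo K E hKd hKi hEd hEi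

/-- `⟦π⟧ ∈ K[⟦K(3−2√2)⟧, ⟦E(3−2√2)⟧]`: Legendre's relation in `P` (THEOREM XVII) at `μ = 1/2`
and the Landen invariance of the hull. [this work] -/
theorem soloInformed_piRep_mem_hull_ellipticThreeSubTwoSqrtTwo (K E : IntegralRep 1)
    (hKd : K.domain = {x : Fin 1 → ℝ | x 0 ∈ Ioo (0:ℝ) 1})
    (hKi : EqOn K.integrand
      (fun x => (√(1 - x 0 ^ 2))⁻¹ * (√(1 - (3 - 2 * √2) ^ 2 * x 0 ^ 2))⁻¹) K.domain)
    (hEd : E.domain = {x : Fin 1 → ℝ | x 0 ∈ Ioo (0:ℝ) 1})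
    (hEi : EqOn E.integrand (fun x => (1 - (3 - 2 * √2) ^ 2 * x 0 ^ 2) *
      ((√(1 - x 0 ^ 2))⁻¹ * (√(1 - (3 - 2 * √2) ^ 2 * x 0 ^ 2))⁻¹)) E.domain) :
    toFormalPeriod (of KZ.piRep) ∈
      soloInformedAlgHull ![toFormalPeriod (of K), toFormalPeriod (of E)] := by
  have hμ : (1 / 2 : ℝ) ∈ Ioo (0:ℝ) 1 := ⟨by norm_num, by norm_num⟩
  have hμa : IsAlgebraic ℚ (1 / 2 : ℝ) := by
    simpa using (isAlgebraic_nat (R := ℚ) (A := ℝ) 2).inv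
  obtain ⟨K₁, hK₁d, hK₁i⟩ := soloInformed_exists_ellipticK_rep (1 / 2) hμ hμa
  obtain ⟨E₁, hE₁d, hE₁i⟩ := soloInformed_exists_ellipticE_rep (1 / 2) hμ hμa
  rw [soloInformed_algHull_ellipticThreeSubTwoSqrtTwo K E K₁ E₁ hKd hKi hEd hEi hK₁d
    (fun x _ => hK₁i x) hE₁d (fun x _ => hE₁i x)]
  exact soloInformed_piRep_mem_hull_ellipticHalf K₁ E₁ hK₁d (fun x _ => hK₁i x) hE₁d
    (fun x _ => hE₁i x)

/-- **COROLLARY XXIII.2 with the representations discharged**: Legendre representations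
`K(3−2√2)`, `E(3−2√2)` on `(0,1)` exist; their values are algebraically independent; `⟦π⟧` lies
in their `K`-hull; and KZP holds on the hull — no hypothesis. [this work] -/
theorem soloInformed_kzp_on_hull_ellipticThreeSubTwoSqrtTwo_exists :
    ∃ K E : IntegralRep 1,
      K.domain = {x : Fin 1 → ℝ | x 0 ∈ Ioo (0:ℝ) 1} ∧
      (∀ x, K.integrand x = (√(1 - x 0 ^ 2))⁻¹ * (√(1 - (3 - 2 * √2) ^ 2 * x 0 ^ 2))⁻¹) ∧
      E.domain = {x : Fin 1 → ℝ | x 0 ∈ Ioo (0:ℝ) 1} ∧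
      (∀ x, E.integrand x = (1 - (3 - 2 * √2) ^ 2 * x 0 ^ 2) *
        ((√(1 - x 0 ^ 2))⁻¹ * (√(1 - (3 - 2 * √2) ^ 2 * x 0 ^ 2))⁻¹)) ∧
      AlgebraicIndependent ℚ ![K.value, E.value] ∧
      toFormalPeriod (of KZ.piRep) ∈
        soloInformedAlgHull ![toFormalPeriod (of K), toFormalPeriod (of E)] ∧
      ∀ {n m : ℕ} (r : IntegralRep n) (r' : IntegralRep m),
        toFormalPeriod (of r) ∈ soloInformedAlgHull ![toFormalPeriod (of K), toFormalPeriod (of E)] →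
        toFormalPeriod (of r') ∈ soloInformedAlgHull ![toFormalPeriod (of K), toFormalPeriod (of E)] →
        r.value = r'.value → Equivalent r r' := by
  have hs2 : (√2 : ℝ) ^ 2 = 2 := Real.sq_sqrt (by norm_num)
  have hlo : (4 / 3 : ℝ) < √2 := by nlinarith [Real.sqrt_nonneg 2]
  have hhi : (√2 : ℝ) < 3 / 2 := by nlinarith [Real.sqrt_nonneg 2]
  have hμ : ((3 - 2 * √2) ^ 2 : ℝ) ∈ Ioo (0:ℝ) 1 := ⟨by nlinarith, by nlinarith⟩
  have h2a : IsAlgebraic ℚ (√2 : ℝ) := ⟨Polynomial.X ^ 2 - Polynomial.C 2,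
    (Polynomial.monic_X_pow_sub_C (2 : ℚ) two_ne_zero).ne_zero, by simp [Real.sq_sqrt]⟩
  have hμa : IsAlgebraic ℚ ((3 - 2 * √2) ^ 2 : ℝ) :=
    ((isAlgebraic_nat (R := ℚ) (A := ℝ) 3).sub ((isAlgebraic_nat (R := ℚ) (A := ℝ) 2).mul h2a)).pow 2
  obtain ⟨K, hKd, hKi⟩ := soloInformed_exists_ellipticK_rep _ hμ hμa
  obtain ⟨E, hEd, hEi⟩ := soloInformed_exists_ellipticE_rep _ hμ hμa
  exact ⟨K, E, hKd, hKi, hEd, hEi,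
    soloInformed_algebraicIndependent_ellipticThreeSubTwoSqrtTwo K E hKd (fun x _ => hKi x) hEd
      (fun x _ => hEi x),
    soloInformed_piRep_mem_hull_ellipticThreeSubTwoSqrtTwo K E hKd (fun x _ => hKi x) hEd
      (fun x _ => hEi x),
    fun r r' hr hr' hv => soloInformed_kzp_on_hull_ellipticThreeSubTwoSqrtTwo K E hKd
      (fun x _ => hKi x) hEd (fun x _ => hEi x) r r' hr hr' hv⟩

end Summit.KontsevichZagierPeriods.KontsevichZagierPeriods.Theorems
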